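import Summits.Ventures.LatticeQCDFlow.TrivializingMaps.WilsonLinkLocality
import Summits.Ventures.LatticeQCDFlow.TrivializingMaps.HaarFibreAverages
import Literature.MathematicalPhysics.QuantumFieldTheory.LatticeGaugeDobrushinPoincare

/-!
HONEST FRAMING: exact (Metropolis-corrected) sampling algorithms for lattice gauge theory; figures
of merit are autocorrelation/cost numbers at stated couplings and volumes; no continuum-physics
claim.

# WilsonLinkFibre — ALONG THE HAAR FIBRE OF A LINK `e ∈ p` THE PLAQUETTE TERM IS `Re tr ρ(h·K)`; THE
# FIBRE MEAN OF `S_e` IS CONSTANT; **`E_D[ Var_ν[h ↦ S_e(h ·_e U)] ] = Var_D(S_e) = #plaqThrough(e) ·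
# Var_Haar(Re tr ρ)`** FOR EVERY COMPACT GAUGE GROUP AND UNITARY `ρ` (lean-2 GEN-9, ours)

Venture-side (OURS).  Cell `lqcd-flow` (pub-lqcd), unit `pub-lqcd-lean-2-g9`, 2026-08-22.  The
`β = 0` input of the `β ≠ 0` extensive variance floor (`WilsonVarianceFloorAllCouplings`): the expected
Haar fibre variance of the link-local action `S_e = linkAction ρ e` (`WilsonLinkLocality`) under
`D[U]`, computed exactly.

* §1 trace algebra from the Literature (`re_trace_map_mul_comm`, `re_trace_map_inv`).
* §2 the four positions of a link in a plaquette (`L ≥ 2`): `plaquetteHolonomy_mulSingle_pos2/3/4`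
  (position 1 is the tree's `plaquetteHolonomy_mulSingle_left`); **`exists_plaqRe_fibre_eq`** — for
  `e ∈ plaqLinks p` there is `K ∈ G` (depending on `U`, not on `h`) with
  `Re tr ρ((h ·_e U)_p) = Re tr ρ(h K)` for all `h`.
* §3 **`integral_plaqRe_fibre`** (`∫ Re tr ρ((h ·_e U)_p) dν(h) = ∫ Re tr ρ dν`, right invariance),
  **`integral_linkAction_fibre`** (`∫ S_e(h ·_e U) dν(h) = #plaqThrough(e)·(N − ∫ Re tr ρ dν)`, a
  constant).
* §4 **`variance_sum_plaqRe_eq`** (`Var_D(∑_{p∈T} Re tr ρ(U_p)) = #T · Var_Haar(Re tr ρ)`, `L ≥ 2`, any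
  finite set `T` of plaquettes — `PlaquetteDecorrelation` for a sub-sum), **`variance_linkAction_eq`**,
  **`integral_fibreVariance_linkAction_eq`** (`E_D[Var_ν[h ↦ S_e(h ·_e U)]] = Var_D(S_e)`), hence
  **`integral_fibreVariance_linkAction`** (`= #plaqThrough(e) · Var_Haar(Re tr ρ)`).

NOT CLAIMED: `L = 1`; non-unitary `ρ`; the value of `#plaqThrough(e)` (`= 2(d−1)`).  Literature grade
(cell rule): elementary; new typing only.
-/

noncomputable section

open MeasureTheory ProbabilityTheory Filter Topology Set
open Literature.MathematicalPhysics.QuantumFieldTheory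
open Literature.MathematicalPhysics.QuantumFieldTheory.Luscher2010
open scoped Matrix ComplexConjugate

namespace Summit.Ventures.LatticeQCDFlow.TrivializingMaps

variable {d L N : ℕ} [NeZero L] {G : Type*} [Group G] (ρ : G →* Matrix (Fin N) (Fin N) ℂ)

/-! ## §1 Trace algebra: `Re tr ρ(ab) = Re tr ρ(ba)` and `Re tr ρ(g⁻¹) = Re tr ρ(g)` (unitary `ρ`) are the
Literature's `re_trace_map_mul_comm` / `re_trace_map_inv` (`LatticeGaugeDobrushinPoincare`, stated there
for the `ℤ^d` single-link update of Shen–Zhu–Zhu; the torus positions below are this file's). -/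

/-! ## §2 The four positions of a link in a plaquette -/

section Positions

variable (U : GaugeConfig d L G) (x : Site d L) {i j : Fin d}

/-- Position 2: left-multiplying `U(x+î, j)` by `h` conjugates `h` into the holonomy:
`(h ·_e U)_p = U(x,i) · h · U(x,i)⁻¹ · U_p` (`i ≠ j`, `L ≥ 2`). [folklore] -/
theorem plaquetteHolonomy_mulSingle_pos2 (hL : 2 ≤ L) (hij : i ≠ j) (h : G) :
    plaquetteHolonomy (Pi.mulSingle (x.shift i, j) h * U) x i j =
      U (x, i) * h * (U (x, i))⁻¹ * plaquetteHolonomy U x i j := by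
  have h1 : ((x, i) : Edge d L) ≠ (x.shift i, j) := fun e => hij (congrArg Prod.snd e)
  have h3 : ((x.shift j, i) : Edge d L) ≠ (x.shift i, j) := fun e => hij (congrArg Prod.snd e)
  have h4 : ((x, j) : Edge d L) ≠ (x.shift i, j) := fun e =>
    (site_shift_ne_self_of_two_le hL x i) (congrArg Prod.fst e).symm
  simp only [plaquetteHolonomy, Pi.mul_apply, Pi.mulSingle_eq_same, Pi.mulSingle_eq_of_ne h1,
    Pi.mulSingle_eq_of_ne h3, Pi.mulSingle_eq_of_ne h4, one_mul]
  group

/-- Position 3: left-multiplying the reversed link `U(x+ĵ, i)` by `h`: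
`(h ·_e U)_p = U(x,i) U(x+î,j) U(x+ĵ,i)⁻¹ · h⁻¹ · U(x,j)⁻¹` (`i ≠ j`, `L ≥ 2`). [folklore] -/
theorem plaquetteHolonomy_mulSingle_pos3 (hL : 2 ≤ L) (hij : i ≠ j) (h : G) :
    plaquetteHolonomy (Pi.mulSingle (x.shift j, i) h * U) x i j =
      U (x, i) * U (x.shift i, j) * (U (x.shift j, i))⁻¹ * h⁻¹ * (U (x, j))⁻¹ := by
  have h1 : ((x, i) : Edge d L) ≠ (x.shift j, i) := fun e =>
    (site_shift_ne_self_of_two_le hL x j) (congrArg Prod.fst e).symm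
  have h2 : ((x.shift i, j) : Edge d L) ≠ (x.shift j, i) := fun e => hij.symm (congrArg Prod.snd e)
  have h4 : ((x, j) : Edge d L) ≠ (x.shift j, i) := fun e => hij.symm (congrArg Prod.snd e)
  simp only [plaquetteHolonomy, Pi.mul_apply, Pi.mulSingle_eq_same, Pi.mulSingle_eq_of_ne h1,
    Pi.mulSingle_eq_of_ne h2, Pi.mulSingle_eq_of_ne h4, one_mul, mul_inv_rev]
  group

/-- Position 4: left-multiplying the reversed link `U(x, j)` by `h`: `(h ·_e U)_p = U_p · h⁻¹`
(`i ≠ j`, `L ≥ 2`). [folklore] -/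
theorem plaquetteHolonomy_mulSingle_pos4 (hL : 2 ≤ L) (hij : i ≠ j) (h : G) :
    plaquetteHolonomy (Pi.mulSingle (x, j) h * U) x i j = plaquetteHolonomy U x i j * h⁻¹ := by
  have h1 : ((x, i) : Edge d L) ≠ (x, j) := fun e => hij (congrArg Prod.snd e)
  have h2 : ((x.shift i, j) : Edge d L) ≠ (x, j) := fun e =>
    (site_shift_ne_self_of_two_le hL x i) (congrArg Prod.fst e)
  have h3 : ((x.shift j, i) : Edge d L) ≠ (x, j) := fun e => hij (congrArg Prod.snd e)
  simp only [plaquetteHolonomy, Pi.mul_apply, Pi.mulSingle_eq_same, Pi.mulSingle_eq_of_ne h1,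
    Pi.mulSingle_eq_of_ne h2, Pi.mulSingle_eq_of_ne h3, one_mul, mul_inv_rev]
  group

/-- **Along the fibre of a link `e ∈ p` the plaquette term is `Re tr ρ(h K)`**: for `L ≥ 2`, unitary
`ρ` and `e ∈ plaqLinks p` there is `K ∈ G` (depending on the configuration, not on `h`) with
`Re tr ρ((h ·_e U)_p) = Re tr ρ(h K)` for every `h ∈ G`. [ours] -/
theorem exists_plaqRe_fibre_eq (hL : 2 ≤ L) (hρu : ∀ g, ρ g ∈ Matrix.unitaryGroup (Fin N) ℂ)
    {p : Plaquette d L} {e : Edge d L} (he : e ∈ plaqLinks p) (U : GaugeConfig d L G) :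
    ∃ K : G, ∀ h : G, WilsonRP.plaqRe ρ (Pi.mulSingle e h * U) p = (ρ (h * K)).trace.re := by
  obtain ⟨y, ⟨⟨i, j⟩, hij⟩⟩ := p
  have hij' : i ≠ j := ne_of_lt hij
  simp only [mem_plaqLinks_iff] at he
  unfold WilsonRP.plaqRe
  simp only
  rcases he with rfl | rfl | rfl | rfl
  · -- position 1: `(h ·_e U)_p = h · U_p`
    exact ⟨plaquetteHolonomy U y i j, fun h => by rw [plaquetteHolonomy_mulSingle_left hL U y hij' h]⟩
  · -- position 2: `U(y,i) h U(y,i)⁻¹ U_p`, cyclicity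
    refine ⟨(U (y, i))⁻¹ * plaquetteHolonomy U y i j * U (y, i), fun h => ?_⟩
    rw [plaquetteHolonomy_mulSingle_pos2 U y hL hij' h,
      show U (y, i) * h * (U (y, i))⁻¹ * plaquetteHolonomy U y i j =
        U (y, i) * (h * ((U (y, i))⁻¹ * plaquetteHolonomy U y i j)) by group,
      re_trace_map_mul_comm ρ]
    congr 3
    group
  · -- position 3: `A h⁻¹ B`; unitarity flips the inverse, then cyclicity
    refine ⟨U (y.shift j, i) * (U (y.shift i, j))⁻¹ * (U (y, i))⁻¹ * U (y, j), fun h => ?_⟩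
    rw [plaquetteHolonomy_mulSingle_pos3 U y hL hij' h, ← re_trace_map_inv ρ hρu]
    rw [show (U (y, i) * U (y.shift i, j) * (U (y.shift j, i))⁻¹ * h⁻¹ * (U (y, j))⁻¹)⁻¹ =
        U (y, j) * (h * (U (y.shift j, i) * (U (y.shift i, j))⁻¹ * (U (y, i))⁻¹)) by group,
      re_trace_map_mul_comm ρ]
    congr 3
    group
  · -- position 4: `U_p h⁻¹`; unitarity flips the inverse
    refine ⟨(plaquetteHolonomy U y i j)⁻¹, fun h => ?_⟩
    rw [plaquetteHolonomy_mulSingle_pos4 U y hL hij' h, ← re_trace_map_inv ρ hρu, mul_inv_rev, inv_inv]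

end Positions

/-! ## §3 Fibre means: one plaquette, the link-local action -/

section FibreMean

variable [TopologicalSpace G] [IsTopologicalGroup G] [CompactSpace G] [MeasurableSpace G] [BorelSpace G]

/-- **`∫ Re tr ρ((h ·_e U)_p) dν(h) = ∫_G Re tr ρ dν`** for `e ∈ plaqLinks p`, `L ≥ 2`, unitary `ρ` (right
invariance of Haar). [ours] -/
theorem integral_plaqRe_fibre (hL : 2 ≤ L) (hρu : ∀ g, ρ g ∈ Matrix.unitaryGroup (Fin N) ℂ)
    {p : Plaquette d L} {e : Edge d L} (he : e ∈ plaqLinks p) (U : GaugeConfig d L G) :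
    ∫ h, WilsonRP.plaqRe ρ (Pi.mulSingle e h * U) p ∂(haarProbability G) =
      ∫ g, (ρ g).trace.re ∂(haarProbability G) := by
  obtain ⟨K, hK⟩ := exists_plaqRe_fibre_eq ρ hL hρu he U
  simp only [hK]
  exact integral_mul_right_eq_self (μ := haarProbability G) (fun g => (ρ g).trace.re) K

/-- **The fibre mean of the link-local action is a constant**:
`∫ S_e(h ·_e U) dν(h) = #plaqThrough(e) · (N − ∫_G Re tr ρ dν)` for every configuration `U`
(`L ≥ 2`, unitary continuous `ρ`). [ours] -/
theorem integral_linkAction_fibre (hL : 2 ≤ L) (hρ : Continuous ρ)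
    (hρu : ∀ g, ρ g ∈ Matrix.unitaryGroup (Fin N) ℂ) (e : Edge d L) (U : GaugeConfig d L G) :
    ∫ h, linkAction ρ e (Pi.mulSingle e h * U) ∂(haarProbability G) =
      (plaqThrough e).card * ((N : ℝ) - ∫ g, (ρ g).trace.re ∂(haarProbability G)) := by
  unfold linkAction
  have hint : ∀ p ∈ plaqThrough e, Integrable (fun h : G =>
      (N : ℝ) - WilsonRP.plaqRe ρ (Pi.mulSingle e h * U) p) (haarProbability G) := by
    intro p _
    refine (BoundedContinuousFunction.mkOfCompact ⟨_, continuous_const.sub ?_⟩).integrable _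
    unfold WilsonRP.plaqRe
    refine Complex.continuous_re.comp ((Continuous.matrix_trace hρ).comp ?_)
    unfold plaquetteHolonomy
    have := continuous_mulSingle_mul_left (d := d) (L := L) (G := G) e U
    fun_prop
  rw [integral_finsetSum _ hint]
  have hre : Integrable (fun g : G => (ρ g).trace.re) (haarProbability G) :=
    (BoundedContinuousFunction.mkOfCompact ⟨_, Complex.continuous_re.comp (Continuous.matrix_trace hρ)⟩).integrable _
  have hterm : ∀ p ∈ plaqThrough e, ∫ h, ((N : ℝ) - WilsonRP.plaqRe ρ (Pi.mulSingle e h * U) p)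
      ∂(haarProbability G) = (N : ℝ) - ∫ g, (ρ g).trace.re ∂(haarProbability G) := by
    intro p hp
    have hintp : Integrable (fun h : G => WilsonRP.plaqRe ρ (Pi.mulSingle e h * U) p) (haarProbability G) := by
      have := (hint p hp).neg.add (integrable_const (N : ℝ))
      refine this.congr (ae_of_all _ fun h => ?_)
      simp only [Pi.add_apply, Pi.neg_apply]; ring
    rw [integral_sub (integrable_const _) hintp, integral_const, smul_eq_mul, probReal_univ, one_mul,
      integral_plaqRe_fibre ρ hL hρu ((mem_plaqThrough_iff e p).1 hp) U]
  rw [Finset.sum_congr rfl hterm, Finset.sum_const, nsmul_eq_mul]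

end FibreMean

/-! ## §4 `E_D[fibre variance of S_e] = Var_D(S_e) = #plaqThrough(e) · Var_Haar(Re tr ρ)` -/

section FibreVariance

variable [TopologicalSpace G] [IsTopologicalGroup G] [CompactSpace G] [MeasurableSpace G] [BorelSpace G]
  [SecondCountableTopology G]

/-- **`Var_D(∑_{p∈T} Re tr ρ(U_p)) = #T · Var_Haar(Re tr ρ)`** for every finite set `T` of plaquettes,
every `d`, every `L ≥ 2` (distinct plaquettes are uncorrelated at `β = 0`, each is Haar distributed —
`PlaquetteDecorrelation` for a sub-sum). [ours] -/
theorem variance_sum_plaqRe_eq (hρ : Continuous ρ) (hL : 2 ≤ L) (T : Finset (Plaquette d L)) :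
    variance (fun U : GaugeConfig d L G => ∑ p ∈ T, WilsonRP.plaqRe ρ U p) (trivialMeasure G d L) =
      T.card * variance (fun g => (ρ g).trace.re) (haarProbability G) := by
  haveI : IsProbabilityMeasure (trivialMeasure G d L) := trivialMeasure_isProbabilityMeasure
  set φ : G → ℝ := fun g => (ρ g).trace.re with hφdef
  have hφ : Continuous φ := Complex.continuous_re.comp (Continuous.matrix_trace hρ)
  have hclass : ∀ a b : G, φ (a * b * a⁻¹) = φ b := fun a b => by
    simp only [hφdef]
    rw [map_mul, map_mul, Matrix.trace_mul_cycle, ← map_mul, inv_mul_cancel, map_one, one_mul]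
  obtain ⟨C, hC⟩ : ∃ C, ∀ g, ‖φ g‖ ≤ C := ⟨_, (BoundedContinuousFunction.mkOfCompact ⟨φ, hφ⟩).norm_coe_le_norm⟩
  set Xp : Plaquette d L → GaugeConfig d L G → ℝ := fun p U => WilsonRP.plaqRe ρ U p with hXpdef
  have hXφ : ∀ p U, Xp p U = φ (plaquetteHolonomy U p.1 p.2.1.1 p.2.1.2) := fun p U => rfl
  have hXc : ∀ p, Continuous (Xp p) := fun p => by
    simp only [hXpdef]
    unfold WilsonRP.plaqRe
    refine Complex.continuous_re.comp ((Continuous.matrix_trace hρ).comp ?_)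
    unfold plaquetteHolonomy; fun_prop
  have hXm : ∀ p ∈ T, MemLp (Xp p) 2 (trivialMeasure G d L) := fun p _ =>
    MemLp.of_bound (integrable_trivialMeasure_of_continuous_group (hXc p)).aestronglyMeasurable C
      (ae_of_all _ fun U => hC _)
  have hφm : MemLp φ 2 (haarProbability G) := MemLp.of_bound hφ.aestronglyMeasurable C (ae_of_all _ fun g => hC g)
  have hmean : ∀ p : Plaquette d L, ∫ U, Xp p U ∂(trivialMeasure G d L) = ∫ g, φ g ∂(haarProbability G) := fun p => by
    simp only [hXφ]
    exact integral_comp_plaquetteHolonomy_eq_haar_group hL p.1 (ne_of_lt p.2.2) hφ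
  have hsq : ∀ p : Plaquette d L, ∫ U, Xp p U * Xp p U ∂(trivialMeasure G d L) = ∫ g, φ g * φ g ∂(haarProbability G) := fun p => by
    simp only [hXφ]
    exact integral_comp_plaquetteHolonomy_eq_haar_group hL p.1 (ne_of_lt p.2.2) (φ := fun g => φ g * φ g)
      (hφ.mul hφ)
  show variance (fun U => ∑ p ∈ T, Xp p U) (trivialMeasure G d L) = _
  rw [variance_fun_sum' hXm]
  have hcov : ∀ p ∈ T, ∀ q ∈ T, cov[Xp p, Xp q; trivialMeasure G d L] =
      if p = q then variance φ (haarProbability G) else 0 := by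
    intro p hp q hq
    rw [covariance_eq_sub (hXm p hp) (hXm q hq)]
    split_ifs with hpq
    · subst hpq
      rw [← covariance_self hφ.aemeasurable, covariance_eq_sub hφm hφm]
      simp only [Pi.mul_apply, hsq p, hmean p]
    · have hmp := hmean p
      have hmq := hmean q
      simp only [hXφ] at hmp hmq
      simp only [Pi.mul_apply, hXφ]
      rw [integral_classFun_plaquette_mul_eq hL hpq hφ hclass hφ, hmp, hmq]
      ring
  rw [Finset.sum_congr rfl fun p hp => Finset.sum_congr rfl fun q hq => hcov p hp q hq]
  simp only [Finset.sum_ite_eq]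
  rw [Finset.sum_congr rfl fun p hp => if_pos hp, Finset.sum_const, nsmul_eq_mul]

/-- **`Var_D(S_e) = #plaqThrough(e) · Var_Haar(Re tr ρ)`** (`L ≥ 2`). [ours] -/
theorem variance_linkAction_eq (hρ : Continuous ρ) (hL : 2 ≤ L) (e : Edge d L) :
    variance (linkAction (d := d) (L := L) ρ e) (trivialMeasure G d L) =
      (plaqThrough e).card * variance (fun g => (ρ g).trace.re) (haarProbability G) := by
  have hfun : linkAction (d := d) (L := L) ρ e =
      fun U => -(∑ p ∈ plaqThrough e, WilsonRP.plaqRe ρ U p) + (N : ℝ) * (plaqThrough e).card := by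
    funext U
    unfold linkAction
    rw [Finset.sum_sub_distrib, Finset.sum_const, nsmul_eq_mul]; ring
  have hc : Continuous fun U : GaugeConfig d L G => -(∑ p ∈ plaqThrough e, WilsonRP.plaqRe ρ U p) := by
    refine (continuous_finsetSum _ fun p _ => ?_).neg
    unfold WilsonRP.plaqRe
    refine Complex.continuous_re.comp ((Continuous.matrix_trace hρ).comp ?_)
    unfold plaquetteHolonomy; fun_prop
  haveI : IsProbabilityMeasure (trivialMeasure G d L) := trivialMeasure_isProbabilityMeasure
  rw [hfun, variance_add_const hc.aestronglyMeasurable, variance_fun_neg, variance_sum_plaqRe_eq ρ hρ hL]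

/-- **`E_D[ Var_ν[h ↦ S_e(h ·_e U)] ] = Var_D(S_e)`**: the expected Haar fibre variance of the link-local
action equals its full `β = 0` variance (its fibre mean is constant, `integral_linkAction_fibre`).
[ours] -/
theorem integral_fibreVariance_linkAction_eq (hL : 2 ≤ L) (hρ : Continuous ρ)
    (hρu : ∀ g, ρ g ∈ Matrix.unitaryGroup (Fin N) ℂ) (e : Edge d L) :
    ∫ U, variance (fun h => linkAction ρ e (Pi.mulSingle e h * U)) (haarProbability G) ∂(trivialMeasure G d L) =
      variance (linkAction (d := d) (L := L) ρ e) (trivialMeasure G d L) := by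
  haveI : IsProbabilityMeasure (trivialMeasure G d L) := trivialMeasure_isProbabilityMeasure
  have hf : Continuous (linkAction (d := d) (L := L) ρ e) := continuous_linkAction ρ hρ e
  obtain ⟨Mbar, hMbar⟩ : ∃ M : ℝ, M = (plaqThrough e).card * ((N : ℝ) - ∫ g, (ρ g).trace.re ∂(haarProbability G)) :=
    ⟨_, rfl⟩
  have hfibmean : ∀ U : GaugeConfig d L G,
      ∫ h, linkAction ρ e (Pi.mulSingle e h * U) ∂(haarProbability G) = Mbar := fun U => by
    rw [hMbar]; exact integral_linkAction_fibre ρ hL hρ hρu e U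
  have hFc : ∀ U : GaugeConfig d L G, Continuous fun h : G => linkAction ρ e (Pi.mulSingle e h * U) :=
    fun U => hf.comp (continuous_mulSingle_mul_left e U)
  -- pointwise: the fibre variance is `∫ F² dν − Mbar²`
  have hpt : ∀ U : GaugeConfig d L G, variance (fun h => linkAction ρ e (Pi.mulSingle e h * U)) (haarProbability G) =
      (∫ h, linkAction ρ e (Pi.mulSingle e h * U) ^ 2 ∂(haarProbability G)) - Mbar ^ 2 := by
    intro U
    have hmem : MemLp (fun h => linkAction ρ e (Pi.mulSingle e h * U)) 2 (haarProbability G) :=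
      MemLp.of_bound (hFc U).aestronglyMeasurable (2 * N * (plaqThrough e).card) (ae_of_all _ fun h => by
        rw [Real.norm_eq_abs, abs_of_nonneg (linkAction_nonneg ρ hρ e _)]
        exact linkAction_le ρ hρ e _)
    rw [variance_eq_sub hmem]
    simp only [Pi.pow_apply]
    rw [hfibmean U]
  -- integrate over `U`: fibre averages of `S_e²` and of `S_e`
  have hsqavg := integral_eq_integral_fibre (G := G) e (Φ := fun U => linkAction ρ e U ^ 2) (hf.pow 2)
  have havg := integral_eq_integral_fibre (G := G) e (Φ := linkAction (d := d) (L := L) ρ e) hf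
  have hmeanD : ∫ U, linkAction ρ e U ∂(trivialMeasure G d L) = Mbar := by
    rw [havg]
    simp only [hfibmean, integral_const, smul_eq_mul, probReal_univ, one_mul]
  have hmemD : MemLp (linkAction (d := d) (L := L) ρ e) 2 (trivialMeasure G d L) :=
    MemLp.of_bound (integrable_trivialMeasure_of_continuous_group hf).aestronglyMeasurable
      (2 * N * (plaqThrough e).card) (ae_of_all _ fun U => by
        rw [Real.norm_eq_abs, abs_of_nonneg (linkAction_nonneg ρ hρ e _)]
        exact linkAction_le ρ hρ e _)
  have hcont : Continuous (Function.uncurry fun (U : GaugeConfig d L G) (h : G) =>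
      linkAction ρ e (Pi.mulSingle e h * U) ^ 2) := by
    rw [Function.uncurry_def]
    exact (hf.comp (((continuous_mulSingle_link (d := d) (L := L) e).comp continuous_snd).mul
      continuous_fst)).pow 2
  have hcI : Continuous fun U : GaugeConfig d L G =>
      ∫ h, linkAction ρ e (Pi.mulSingle e h * U) ^ 2 ∂(haarProbability G) :=
    continuous_integral_param (haarProbability G) hcont
  have hintsq : Integrable (fun U : GaugeConfig d L G =>
      ∫ h, linkAction ρ e (Pi.mulSingle e h * U) ^ 2 ∂(haarProbability G)) (trivialMeasure G d L) :=
    integrable_trivialMeasure_of_continuous_group hcI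
  calc ∫ U, variance (fun h => linkAction ρ e (Pi.mulSingle e h * U)) (haarProbability G) ∂(trivialMeasure G d L)
      = ∫ U, ((∫ h, linkAction ρ e (Pi.mulSingle e h * U) ^ 2 ∂(haarProbability G)) - Mbar ^ 2)
          ∂(trivialMeasure G d L) := by
        apply integral_congr_ae
        filter_upwards with U using hpt U
    _ = (∫ U, linkAction ρ e U ^ 2 ∂(trivialMeasure G d L)) - Mbar ^ 2 := by
        rw [integral_sub hintsq (integrable_const _), integral_const, smul_eq_mul, probReal_univ, one_mul,
          ← hsqavg]
    _ = variance (linkAction (d := d) (L := L) ρ e) (trivialMeasure G d L) := by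
        rw [variance_eq_sub hmemD]
        simp only [Pi.pow_apply]
        rw [hmeanD]

/-- **`E_D[ Var_ν[h ↦ S_e(h ·_e U)] ] = #plaqThrough(e) · Var_Haar(Re tr ρ)`** (`L ≥ 2`, unitary
continuous `ρ`, every compact second-countable `G`). [ours] -/
theorem integral_fibreVariance_linkAction (hL : 2 ≤ L) (hρ : Continuous ρ)
    (hρu : ∀ g, ρ g ∈ Matrix.unitaryGroup (Fin N) ℂ) (e : Edge d L) :
    ∫ U, variance (fun h => linkAction ρ e (Pi.mulSingle e h * U)) (haarProbability G) ∂(trivialMeasure G d L) =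
      (plaqThrough e).card * variance (fun g => (ρ g).trace.re) (haarProbability G) := by
  rw [integral_fibreVariance_linkAction_eq ρ hL hρ hρu, variance_linkAction_eq ρ hρ hL]

end FibreVariance

end Summit.Ventures.LatticeQCDFlow.TrivializingMaps
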